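import Summits.Ventures.PercRepro.C025ProfileThinGirthD
import Summits.Ventures.PercRepro.C025ProfileThinGirthArith4
import Summits.Ventures.PercRepro.C025ProfileThinTriangleE

/-!
# THE ROW `(q, q+1)` ON THIN MATROIDS WITH A 4-CIRCUIT — part E: THE THEOREM FOR `g = 4` (night-3 g15)
**THEOREM (thin + 4-circuit)** `profileIneq_thinFour` / `hallIneq_thinFour`: for every `q ≥ 6` and every finite matroid of girth `≥ 4`
(every set of `≤ 3` points has full rank) with a 4-circuit `C₀` (`|C₀| = 4`, `ρ(C₀) = 3`) in which every rank-`q` set has at most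
`q + 1` points, the row `(q, q+1)` of C-032 and its Hall form (C-033) hold — for EVERY `n`: the general theorem
`profileIneq_thinGirth_of_weights` (part D) with `g = 4`, the weights of `C025ProfileThinGirthArith4` (`g4_weights`) and the uniform
inner payment `σ = 4/(3f)` when `f = n − q − 1 ≥ q`; the zero certificate (`ThinTriangle.profileIneq_of_small`) when `f < q`.
This closes the thin regime at girth 4 below the size bound of `C025ProfileThinRowF` (`3(n − q − 1) ≥ 4(q − 2)`, i.e. the cells
`q ≥ 12`, `2q + 2 ≤ n < (7q − 5)/3`, e.g. `(q, n) = (12, 26)`), given a 4-circuit. `profileIneq_thinFour_indep`: the hypotheses in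
Mathlib's `M.Indep` terms.
-/
open scoped Matroid
namespace PercRepro
open Set Finset ThmH Staged
namespace ThinGirth
variable {α : Type} [DecidableEq α] {M : Matroid α} [M.Finite]

/-- **THEOREM (thin + 4-circuit)**: `q ≥ 6`, girth `≥ 4`, a 4-circuit `K`, every rank-`q` set with `≤ q + 1` points ⇒ the row
`(q, q+1)` of (Π) and its Hall form, for EVERY `n`. -/
theorem profileIneq_thinFour (q : ℕ) (hq6 : 6 ≤ q)
    (hgirth : ∀ X ⊆ gr M, X.card + 1 ≤ 4 → rkN M X = X.card)
    (hthin : ∀ X ⊆ gr M, rkN M X = q → X.card ≤ q + 1)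
    (K : Finset α) (hKg : K ⊆ gr M) (hK4 : K.card = 4) (hKrk : rkN M K + 1 = 4) :
    Profile.ProfileIneq M q (q + 1) ∧ Profile.HallIneq M q (q + 1) := by
  rcases Nat.lt_or_ge ((gr M).card - q - 1) q with hlt | hge
  · exact ThinTriangle.profileIneq_of_small q hlt
  · have hw := g4_weights (q := q) (f := (gr M).card - q - 1) hq6 hge
    dsimp only at hw
    set f : ℚ := (((gr M).card - q - 1 : ℕ) : ℚ) with hfdef
    set sQ : ℚ := 3 / (4 * ((q : ℚ) - 2)) with hsQdef
    set a3 : ℚ := 1 + 1 / f - sQ with ha3def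
    set b2 : ℚ := ((q : ℚ) + 1 - ((q : ℚ) - 2) * a3) / 3 with hb2def
    set a2 : ℚ := (f + 1 - 2 * b2) / (f - 1) with ha2def
    set b1 : ℚ := ((q : ℚ) + 1 - ((q : ℚ) - 1) * a2) / 2 with hb1def
    set a1 : ℚ := (f + 1 - 3 * b1) / (f - 2) with ha1def
    set b0 : ℚ := (q : ℚ) + 1 - (q : ℚ) * a1 with hb0def
    obtain ⟨⟨ha1, ha2, ha3, hb0, hb1, hb2, hsQ⟩, ⟨ha1', ha2', ha3', hb0', hb1', hb2'⟩, ⟨hkey, hd2, hd1, hdtop⟩,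
      ⟨hc1, hc2, hc3, hcQ⟩⟩ := hw
    have hfpos : (0 : ℚ) < f := by rw [hfdef]; exact_mod_cast (by omega : 0 < (gr M).card - q - 1)
    have hqf : (q : ℚ) ≤ f := by rw [hfdef]; exact_mod_cast hge
    have hq6' : (6 : ℚ) ≤ q := by exact_mod_cast hq6
    have hσ43 : f * (4 / (3 * f)) = 4 / 3 := by field_simp
    let a : ℕ → ℚ := fun t => if t = 0 then 1 else if t = 1 then a1 else if t = 2 then a2 else a3
    let b : ℕ → ℚ := fun t => if t = 0 then b0 else if t = 1 then b1 else b2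
    have ea0 : a 0 = 1 := by simp [a]
    have ea1 : a 1 = a1 := by simp [a]
    have ea2 : a 2 = a2 := by simp [a]
    have ea3 : a 3 = a3 := by simp [a]
    have eb0 : b 0 = b0 := by simp [b]
    have eb1 : b 1 = b1 := by simp [b]
    have eb2 : b 2 = b2 := by simp [b]
    have hfcast1 : (((gr M).card - q - 4 + 1 : ℕ) : ℚ) = f - 2 := by
      have e : (gr M).card - q - 4 + 1 = (gr M).card - q - 1 - 2 := by omega
      rw [e, Nat.cast_sub (by omega), hfdef]
      push_cast
      ring
    have hfcast2 : (((gr M).card - q - 4 + 2 : ℕ) : ℚ) = f - 1 := by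
      have e : (gr M).card - q - 4 + 2 = (gr M).card - q - 1 - 1 := by omega
      rw [e, Nat.cast_sub (by omega), hfdef]
      push_cast
      ring
    have hfcast0 : (((gr M).card - q - 4 : ℕ) : ℚ) = f - 3 := by
      have e : (gr M).card - q - 4 = (gr M).card - q - 1 - 3 := by omega
      rw [e, Nat.cast_sub (by omega), hfdef]
      push_cast
      ring
    refine profileIneq_thinGirth_of_weights q 4 (by norm_num) (by omega) hgirth hthin K hKg hK4 hKrk a b sQ
      (4 / (3 * f)) ?_ ?_ hsQ (by positivity) hge ?_ ?_ ?_ ?_ ?_ ?_ ?_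
    · -- `0 ≤ a t`
      intro t
      simp only [a]
      split_ifs <;> first | assumption | norm_num
    · -- `0 ≤ b t`
      intro t
      simp only [b]
      split_ifs <;> assumption
    · -- (Dem) for the types `1` and `2`
      intro t ht1 ht2
      rcases (by omega : t = 1 ∨ t = 2) with rfl | rfl
      · rw [eb1, ea1, hfcast1]
        norm_num
        linarith
      · rw [eb2, ea2, hfcast2]
        norm_num
        linarith
    · -- (Dem) for the type `0`: the KEY `b₀ ≥ 3/4`
      rw [eb0, ea0, hfcast0]
      norm_num
      linarith
    · -- the top demand
      rw [show (4 : ℕ) - 1 = 3 by rfl, ea3]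
      exact le_of_eq hdtop.symm
    · -- `a t, b t ≤ f σ = 4/3` for `t ≤ 2`
      intro t ht
      rw [hσ43]
      rcases (by omega : t = 0 ∨ t = 1 ∨ t = 2) with rfl | rfl | rfl
      · rw [ea0, eb0]; exact ⟨by norm_num, hb0'⟩
      · rw [ea1, eb1]; exact ⟨ha1', hb1'⟩
      · rw [ea2, eb2]; exact ⟨ha2', hb2'⟩
    · -- (Cap) at `s = 0, 1, 2, 3`
      intro s hs
      rcases (by omega : s = 0 ∨ s = 1 ∨ s = 2 ∨ s = 3) with rfl | rfl | rfl | rfl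
      · rw [ea0]
        norm_num
      · have e : ((q + 1 - 1 : ℕ) : ℚ) = q := by rw [Nat.add_sub_cancel]
        rw [show (1 : ℕ) - 1 = 0 by rfl, eb0, ea1, e]
        norm_num
        linarith
      · have e : ((q + 1 - 2 : ℕ) : ℚ) = (q : ℚ) - 1 := by
          rw [show q + 1 - 2 = q - 1 by omega, Nat.cast_sub (by omega)]
          push_cast
          ring
        rw [show (2 : ℕ) - 1 = 1 by rfl, eb1, ea2, e]
        norm_num
        linarith
      · have e : ((q + 1 - 3 : ℕ) : ℚ) = (q : ℚ) - 2 := by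
          rw [show q + 1 - 3 = q - 2 by omega, Nat.cast_sub (by omega)]
          push_cast
          ring
        rw [show (3 : ℕ) - 1 = 2 by rfl, eb2, ea3, e]
        norm_num
        linarith
    · -- the `Q'`-capacity
      have e1 : ((q + 2 - 4 : ℕ) : ℚ) = (q : ℚ) - 2 := by
        rw [show q + 2 - 4 = q - 2 by omega, Nat.cast_sub (by omega)]
        push_cast
        ring
      have e2 : ((4 * (q + 2 - 4) : ℕ) : ℚ) = 4 * ((q : ℚ) - 2) := by
        rw [Nat.cast_mul, e1]
        norm_num
      rw [e1, e2]
      linarith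
    · -- (Cap) (iii): `c + c (q + 2 − c) σ ≤ q + 1` for `c ≤ 3`
      intro c hc
      have h1 : c * (q + 2 - c) ≤ 3 * (q - 1) := by
        rcases (by omega : c = 0 ∨ c = 1 ∨ c = 2 ∨ c = 3) with rfl | rfl | rfl | rfl <;> omega
      have h1' : ((c * (q + 2 - c) : ℕ) : ℚ) ≤ 3 * ((q : ℚ) - 1) := by
        have h1c : ((c * (q + 2 - c) : ℕ) : ℚ) ≤ ((3 * (q - 1) : ℕ) : ℚ) := by exact_mod_cast h1
        have e : ((3 * (q - 1) : ℕ) : ℚ) = 3 * ((q : ℚ) - 1) := by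
          rw [Nat.cast_mul, Nat.cast_sub (by omega)]
          push_cast
          ring
        rw [e] at h1c
        exact h1c
      have h3 : ((q : ℚ) - 1) / f ≤ 1 := by
        rw [div_le_one hfpos]
        linarith
      have h2 : ((c * (q + 2 - c) : ℕ) : ℚ) * (4 / (3 * f)) ≤ 4 := by
        have hσpos : (0 : ℚ) ≤ 4 / (3 * f) := by positivity
        calc ((c * (q + 2 - c) : ℕ) : ℚ) * (4 / (3 * f))
            ≤ 3 * ((q : ℚ) - 1) * (4 / (3 * f)) := mul_le_mul_of_nonneg_right h1' hσpos
          _ = 4 * (((q : ℚ) - 1) / f) := by field_simp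
          _ ≤ 4 * 1 := mul_le_mul_of_nonneg_left h3 (by norm_num)
          _ = 4 := by norm_num
      have hc' : (c : ℚ) ≤ 3 := by exact_mod_cast (by omega : c ≤ 3)
      linarith

/-- THEOREM (thin + 4-circuit), the row alone. -/
theorem profileIneq_thinFour' (q : ℕ) (hq6 : 6 ≤ q)
    (hgirth : ∀ X ⊆ gr M, X.card + 1 ≤ 4 → rkN M X = X.card)
    (hthin : ∀ X ⊆ gr M, rkN M X = q → X.card ≤ q + 1)
    (K : Finset α) (hKg : K ⊆ gr M) (hK4 : K.card = 4) (hKrk : rkN M K + 1 = 4) :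
    Profile.ProfileIneq M q (q + 1) :=
  (profileIneq_thinFour q hq6 hgirth hthin K hKg hK4 hKrk).1

/-- THEOREM (thin + 4-circuit), the Hall form (C-033). -/
theorem hallIneq_thinFour (q : ℕ) (hq6 : 6 ≤ q)
    (hgirth : ∀ X ⊆ gr M, X.card + 1 ≤ 4 → rkN M X = X.card)
    (hthin : ∀ X ⊆ gr M, rkN M X = q → X.card ≤ q + 1)
    (K : Finset α) (hKg : K ⊆ gr M) (hK4 : K.card = 4) (hKrk : rkN M K + 1 = 4) :
    Profile.HallIneq M q (q + 1) :=
  (profileIneq_thinFour q hq6 hgirth hthin K hKg hK4 hKrk).2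

/-- **THEOREM (thin + 4-circuit), independence form**: `q ≥ 6`, every set of `≤ 3` points independent, `K ⊆ E` a dependent 4-set,
every rank-`q` set with `≤ q + 1` points ⇒ the row `(q, q+1)` of (Π) and its Hall form. -/
theorem profileIneq_thinFour_indep (q : ℕ) (hq6 : 6 ≤ q)
    (hgirth : ∀ T ⊆ M.E, T.encard ≤ 3 → M.Indep T)
    (hthin : ∀ X ⊆ gr M, rkN M X = q → X.card ≤ q + 1)
    (K : Finset α) (hKE : (K : Set α) ⊆ M.E) (hK4 : K.card = 4) (hKdep : ¬ M.Indep (K : Set α)) :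
    Profile.ProfileIneq M q (q + 1) ∧ Profile.HallIneq M q (q + 1) := by
  have hKg : K ⊆ gr M := by
    intro k hk
    have : k ∈ ((gr M : Finset α) : Set α) := by rw [coe_gr]; exact hKE hk
    exact_mod_cast this
  have hgirth' : ∀ X ⊆ gr M, X.card + 1 ≤ 4 → rkN M X = X.card := by
    intro X hXg hXc
    have hXE : (X : Set α) ⊆ M.E := by rw [← coe_gr]; exact_mod_cast hXg
    apply OneCircuit.rkN_eq_card_of_indep
    apply hgirth _ hXE
    rw [Set.encard_coe_eq_coe_finsetCard]
    exact_mod_cast (by omega : X.card ≤ 3)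
  have hKrk : rkN M K + 1 = 4 := by
    have hle : rkN M K ≤ 3 := by
      by_contra h
      push Not at h
      have h4 : rkN M K = 4 := le_antisymm (hK4 ▸ rkN_le_card K) (by omega)
      apply hKdep
      rw [Matroid.indep_iff_eRk_eq_encard_of_finite K.finite_toSet, Set.encard_coe_eq_coe_finsetCard, hK4,
        ← rkN_eq_iff, h4]
    obtain ⟨k, hk⟩ : K.Nonempty := Finset.card_pos.mp (by omega)
    have hKk : rkN M (K.erase k) = (K.erase k).card :=
      hgirth' _ ((Finset.erase_subset k K).trans hKg) (by rw [Finset.card_erase_of_mem hk]; omega)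
    have hmono : rkN M (K.erase k) ≤ rkN M K := rkN_mono (Finset.erase_subset k K)
    rw [Finset.card_erase_of_mem hk, hK4] at hKk
    omega
  exact profileIneq_thinFour q hq6 hgirth' hthin K hKg hK4 hKrk

end ThinGirth
end PercRepro
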